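import Mathlib.Analysis.Calculus.LineDeriv.IntegrationByParts
import Mathlib.Analysis.Calculus.FDeriv.WithLp
import Summits.QuantumFields.YangMills.Theorems.IsotropyFromPowerCountingTemperedCurvatureMomentsOfBddRenormalisation
import HarnessLib

/-!
# Stub (W₁) `stub_wardNullity_one` of line `WardDefectSketch` (crux `CurvatureAmnesia`, stmt-QuantumFields-16192)

Degree-one Ward nullity from the lattice tie alone: for one real test function `f₀` the lattice one-point function
of `L f₀ = x₁∂₀f₀ − x₀∂₁f₀` is `κ_k · a_k⁴ Σ_y (L f₀)(a_k y)` (`latticeSchwinger_one_eq`), the renormalised mean `κ_k` is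
eventually bounded along a tied scheme (`eventually_abs_renormalisedMean_le`), and the Riemann sums converge to
`∫ L f₀ = 0` (`tendsto_riemannSum_box` + integration by parts), so the product tends to `0`.
-/

noncomputable section

open scoped BigOperators Topology SchwartzMap LineDeriv
open Filter MeasureTheory
open Literature.MathematicalPhysics.QuantumLattice Literature.MathematicalPhysics.AQFT
  Literature.MathematicalPhysics.QuantumFieldTheory

namespace Summit.QuantumFields.YangMills.Cruxes.CurvatureAmnesia.WardDefect

open Summit.QuantumFields.YangMills.Theorems.SoftKernelBoostCovariance.Sketch
  (latticeSchwinger_one_eq eventually_abs_renormalisedMean_le)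
open Summit.QuantumFields.YangMills.Theorems.NPointIsotropy.ComplexRotationBandlimit (tendsto_riemannSum_box)
open Summit.QuantumFields.YangMills.Theorems.CurvatureBoostCovariance.Negative (Tie)
open Literature.Probability.LatticeModels (box)

/-- The coordinate functions of `ℝ⁴` have temperate growth (they are continuous linear forms). -/
theorem hasTemperateGrowth_coord (j : Fin 4) :
    Function.HasTemperateGrowth (fun x : EuclideanSpace ℝ (Fin 4) => x j) :=
  (EuclideanSpace.proj j : EuclideanSpace ℝ (Fin 4) →L[ℝ] ℝ).hasTemperateGrowth

/-- The derivative of the coordinate `x ↦ x j` along the basis vector `e_i` vanishes for `j ≠ i`. -/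
theorem fderiv_coord_single {i j : Fin 4} (hij : j ≠ i) (x : EuclideanSpace ℝ (Fin 4)) :
    fderiv ℝ (fun x : EuclideanSpace ℝ (Fin 4) => x j) x (EuclideanSpace.single i (1 : ℝ)) = 0 := by
  rw [(PiLp.hasFDerivAt_apply (𝕜 := ℝ) 2 x j).fderiv, PiLp.proj_apply]
  show (EuclideanSpace.single i (1 : ℝ)) j = 0
  rw [PiLp.single_apply, if_neg hij]

/-- **No boundary term for an off-diagonal piece of the rotation generator**: `∫ x_j · ∂_{e_i} g = 0` for a
Schwartz function `g` on `ℝ⁴` and `j ≠ i` (integration by parts, `∂_{e_i} x_j = 0`; all three products are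
Schwartz, hence integrable). -/
theorem integral_coord_mul_lineDerivOp_eq_zero (g : 𝓢(EuclideanSpace ℝ (Fin 4), ℝ)) {i j : Fin 4}
    (hij : j ≠ i) :
    ∫ x : EuclideanSpace ℝ (Fin 4),
      x j * (∂_{(EuclideanSpace.single i (1 : ℝ) : EuclideanSpace ℝ (Fin 4))} g) x = 0 := by
  set v : EuclideanSpace ℝ (Fin 4) := EuclideanSpace.single i (1 : ℝ) with hv
  have hd : ∀ x : EuclideanSpace ℝ (Fin 4), fderiv ℝ (fun x : EuclideanSpace ℝ (Fin 4) => x j) x v = 0 :=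
    fderiv_coord_single hij
  have hT := hasTemperateGrowth_coord j
  have h1 : Integrable (fun x : EuclideanSpace ℝ (Fin 4) =>
      fderiv ℝ (fun x : EuclideanSpace ℝ (Fin 4) => x j) x v * g x) := by
    simp only [hd, zero_mul]
    exact integrable_zero _ _ _
  have h2 : Integrable (fun x : EuclideanSpace ℝ (Fin 4) => x j * fderiv ℝ g x v) :=
    ((SchwartzMap.smulLeftCLM ℝ (fun x : EuclideanSpace ℝ (Fin 4) => x j) (∂_{v} g)).integrable).congr
      (ae_of_all _ fun x => by
        simp [SchwartzMap.smulLeftCLM_apply_apply hT, SchwartzMap.lineDerivOp_apply_eq_fderiv])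
  have h3 : Integrable (fun x : EuclideanSpace ℝ (Fin 4) => x j * g x) :=
    ((SchwartzMap.smulLeftCLM ℝ (fun x : EuclideanSpace ℝ (Fin 4) => x j) g).integrable).congr
      (ae_of_all _ fun x => by simp [SchwartzMap.smulLeftCLM_apply_apply hT])
  have h := integral_mul_fderiv_eq_neg_fderiv_mul_of_integrable h1 h2 h3
    (fun x _ => (PiLp.hasFDerivAt_apply (𝕜 := ℝ) 2 x j).differentiableAt) (fun x _ => g.differentiableAt)
  simp only [SchwartzMap.lineDerivOp_apply_eq_fderiv]
  rw [h]
  simp [hd]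

/-- **The rotation generator has no zero mode**: `∫ (x₁∂₀g − x₀∂₁g) = 0` for every Schwartz `g` on `ℝ⁴`. -/
theorem integral_rotationGenerator_eq_zero (g : 𝓢(EuclideanSpace ℝ (Fin 4), ℝ)) :
    ∫ x : EuclideanSpace ℝ (Fin 4),
      (SchwartzMap.smulLeftCLM ℝ (fun x : EuclideanSpace ℝ (Fin 4) => x 1)
          (LineDeriv.lineDerivOp (EuclideanSpace.single (0 : Fin 4) (1 : ℝ) : EuclideanSpace ℝ (Fin 4)) g) -
        SchwartzMap.smulLeftCLM ℝ (fun x : EuclideanSpace ℝ (Fin 4) => x 0)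
          (LineDeriv.lineDerivOp (EuclideanSpace.single (1 : Fin 4) (1 : ℝ) : EuclideanSpace ℝ (Fin 4)) g)) x =
      0 := by
  simp only [sub_apply]
  rw [integral_sub (SchwartzMap.integrable _) (SchwartzMap.integrable _)]
  simp only [SchwartzMap.smulLeftCLM_apply_apply (hasTemperateGrowth_coord _), smul_eq_mul]
  rw [integral_coord_mul_lineDerivOp_eq_zero g (by decide), integral_coord_mul_lineDerivOp_eq_zero g (by decide),
    sub_zero]

/-- **(W₁) Ward nullity in degree one** (registered stub `stub_wardNullity_one`, verbatim). -/
theorem stub_wardNullity_one :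
    ∀ (G : Type) [Group G] [TopologicalSpace G] [IsTopologicalGroup G] [CompactSpace G] [MeasurableSpace G]
      [BorelSpace G] (r : LatticeRep G) (sch : SpeciesScheme (YMSpecies G))
      (S : LabelledSchwingerFamily (YMSpecies G) (EuclideanSpace ℝ (Fin 4))),
      (∀ (n : ℕ), n ≠ 0 → ∀ (σ : Fin n → YMSpecies G) (f : Fin n → 𝓢(EuclideanSpace ℝ (Fin 4), ℝ))
        (F : 𝓢((Fin n → EuclideanSpace ℝ (Fin 4)), ℂ)),
        IsTensorOf F (fun i => ofRealTest (f i)) → IsOffDiagonal F →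
          Tendsto (fun k : ℕ => ((latticeSchwinger r.ρ sch (fun s => s.F) k n σ f : ℝ) : ℂ)) atTop
            (𝓝 (S n σ F))) →
      ∀ (f : Fin 1 → 𝓢(EuclideanSpace ℝ (Fin 4), ℝ)),
        Tendsto
          (fun k : ℕ => ∑ i : Fin 1,
            latticeSchwinger r.ρ sch (fun s => s.F) k 1 (fun _ => r.curvature)
              (Function.update f i
                (SchwartzMap.smulLeftCLM ℝ (fun x : EuclideanSpace ℝ (Fin 4) => x 1)
                    (LineDeriv.lineDerivOp (EuclideanSpace.single (0 : Fin 4) (1 : ℝ) :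
                      EuclideanSpace ℝ (Fin 4)) (f i)) -
                  SchwartzMap.smulLeftCLM ℝ (fun x : EuclideanSpace ℝ (Fin 4) => x 0)
                    (LineDeriv.lineDerivOp (EuclideanSpace.single (1 : Fin 4) (1 : ℝ) :
                      EuclideanSpace ℝ (Fin 4)) (f i)))))
          atTop (𝓝 0) := by
  intro G _ _ _ _ _ _ r sch S hconv f
  -- the test function `h = L f₀`
  set h : 𝓢(EuclideanSpace ℝ (Fin 4), ℝ) :=
    SchwartzMap.smulLeftCLM ℝ (fun x : EuclideanSpace ℝ (Fin 4) => x 1)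
        (LineDeriv.lineDerivOp (EuclideanSpace.single (0 : Fin 4) (1 : ℝ) : EuclideanSpace ℝ (Fin 4)) (f 0)) -
      SchwartzMap.smulLeftCLM ℝ (fun x : EuclideanSpace ℝ (Fin 4) => x 0)
        (LineDeriv.lineDerivOp (EuclideanSpace.single (1 : Fin 4) (1 : ℝ) : EuclideanSpace ℝ (Fin 4)) (f 0))
    with hh
  -- the tie of the curvature channel, from the hypothesis
  set S₁ : SchwingerFamily (EuclideanSpace ℝ (Fin 4)) := fun n => S n (fun _ => r.curvature) with hS₁
  have htie : Tie r sch S₁ := fun n hn f' F hF hF' => hconv n hn (fun _ => r.curvature) f' F hF hF'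
  -- `κ_k` is eventually bounded, the Riemann sums of `h` tend to `∫ h = 0`
  obtain ⟨K, hK⟩ := eventually_abs_renormalisedMean_le r sch S₁ htie
  have hR : Tendsto (fun k => sch.a k ^ 4 * ∑ y ∈ box 4 (sch.L k), h (sch.a k • siteToE y)) atTop (𝓝 0) := by
    have h0 : (∫ x, h x) = 0 := integral_rotationGenerator_eq_zero (f 0)
    rw [← h0]
    exact tendsto_riemannSum_box h sch.a sch.L sch.a_pos sch.tendsto_a sch.tendsto_L
  have key := bdd_le_mul_tendsto_zero' K hK hR
  -- rewrite the goal: one summand, `Function.update f 0 h = fun _ => h`, and the degree-one formula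
  have hupd : Function.update f 0 h = fun _ => h :=
    funext fun j => by
      obtain rfl : j = 0 := Subsingleton.elim _ _
      exact Function.update_self _ _ _
  refine key.congr fun k => ?_
  rw [Fin.sum_univ_one, hupd, latticeSchwinger_one_eq]

end Summit.QuantumFields.YangMills.Cruxes.CurvatureAmnesia.WardDefect

end
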